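import Summits.SmoothPoincare4.SmoothPoincare4.Theorems.SymplecticOrigamiOrigamiFoldExistenceStubRoundRimNormalForm
import Summits.SmoothPoincare4.SmoothPoincare4.Theorems.SymplecticOrigamiOrigamiFoldExistenceStubPleatFreeStandard
import Summits.SmoothPoincare4.SmoothPoincare4.Theorems.SymplecticOrigamiOrigamiFoldExistenceStubCleanOnePleatIroning
import Summits.SmoothPoincare4.SmoothPoincare4.Theorems.SymplecticOrigamiOrigamiFoldExistenceStubOuterCleanRecognitionOfSide
import Summits.SmoothPoincare4.SmoothPoincare4.Theorems.SymplecticOrigamiOrigamiFoldExistenceStubOuterSideLemma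
import Summits.SmoothPoincare4.SmoothPoincare4.Theorems.SymplecticOrigamiOrigamiFoldExistenceShadowPleatsOuterNormalisationCert
import Summits.SmoothPoincare4.SmoothPoincare4.Theorems.OrigamiFoldExistence.Negative.ZeroSlack
import Summits.SmoothPoincare4.SmoothPoincare4.Theorems.SymplecticOrigamiRoundSphereIsOrigamiFold
import Summits.SmoothPoincare4.SmoothPoincare4.Theses.AlgebraicDegree
import Summits.SmoothPoincare4.SmoothPoincare4.Theses.EuclideanOrigami
import Literature.Topology.Immersions.WrinkledEmbeddingsRoundCollarRoundPart
import Literature.Topology.Immersions.GaussMapDegreeEuler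
import Literature.Topology.FourManifolds.HomotopyS4CompactProofs
import Literature.Topology.FourManifolds.HomotopyS4OrientableProofs

/-!
# The endpoint of line `shadow-pleats` (crux `OrigamiFoldExistence`, stmt-SmoothPoincare4-7844) as tree theorems
(route route-SmoothPoincare4-SymplecticOrigami; line lead seat c6; skeleton r10 = `Cruxes/OrigamiFoldExistence/Lines/shadow_pleats.lean`)

After ten skeleton revisions the line `shadow-pleats` has TWO registered stubs — F1
`stub_eliashbergMishachev2009` (Eliashberg–Mishachev 2009 Thm 3.2 in double-fold, relative, `C⁰`-small form for the
vertical foliation of `ℝ⁵`: a THEOREM IN PRINT, Literature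
`EliashbergMishachev2009_doubleFolds_of_hasTransversalRotation`, formal debt) and S3'' `stub_outerNormalisation` (OPEN) —
and every other rung is a tree theorem: S2 round-rim normal form modulo the facts (p107172), S6 pleat-free ⇒ standard
(p107118), S5a clean one-pleat ironing (p120755), O1 the side lemma (p128530), S4''σ outer-clean recognition (p129050),
transport of the fold data (p72874).  Until now the COMPOSITION of these rungs lived only in the Cruxes workfile.  This
file states and proves it in the tree, with the open inputs as explicit hypotheses spelled verbatim:

* `nonempty_diffeomorph_sphere_of_outerNormalisation` / `smoothPoincare4_of_outerNormalisation` /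
  `origamiFoldExistence_of_outerNormalisation` — the OUTER ladder:
  `EmbedsInR5 ∧ F1 ∧ OuterNormalisation ∧ Schoenflies ∧ Γ₄=0 ⟹ SPC4 ⟹ OrigamiFoldExistence`
  (the round-sphere fold `RoundSphereIsOrigamiFold` is the CLOSED item stmt-7845, discharged here by
  `roundSphereIsOrigamiFold_proof`);
* `nonempty_diffeomorph_sphere_of_cleanNormalisation` / `smoothPoincare4_of_cleanNormalisation` /
  `origamiFoldExistence_of_cleanNormalisation` — the CLEAN ladder, which needs NEITHER the smooth 4-dimensional
  Schoenflies conjecture NOR Cerf's `Γ₄ = 0`: `EmbedsInR5 ∧ F1 ∧ CleanNormalisation₁ ⟹ SPC4`, where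
  CleanNormalisation₁ := every pleated position of a homotopy 4-sphere can be replaced by a CLEAN position with at most
  one chart (rungs S5a + S6 only);
* `cleanNormalisation_of_smoothPoincare4` and `smoothPoincare4_iff_cleanNormalisation` — the converse by transport, hence
  the kernel-visible REFORMULATION  `SPC4 ⟺ CleanNormalisation₁`  modulo the two theorems in print `EmbedsInR5`
  (stmt-3403: Kervaire–Milnor) and F1 (Eliashberg–Mishachev);
* `outerNormalisation_of_cleanNormalisation` — CleanNormalisation₁ ⟹ OuterNormalisation (= S3'' verbatim).

So the open stub S3'' is sandwiched `SPC4 ⟹ CleanNormalisation₁ ⟹ S3''` (`stub_outerNormalisation_of_smoothPoincare4`,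
p-OuterNormalisationCert) and `S3'' ∧ Schoenflies ∧ Γ₄=0 ⟹ SPC4` (this file, modulo `EmbedsInR5`, F1): relative to the
line's standing inputs it is SPC4-equivalent — the line's verdict `promote-stub` (PICKED.md, seat c6).  Pure logic over
landed theorems; no `sorry`, no new definitions.
-/

noncomputable section

-- the prescribed namespace `Summit.<P>.<Sub>.…` duplicates `SmoothPoincare4` (P = Sub)
set_option linter.dupNamespace false

open scoped Manifold ContDiff Topology
open Set Function ContinuousMap

namespace Summit.SmoothPoincare4.SmoothPoincare4.Theorems.OrigamiFoldExistence.ShadowPleats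

/-! ### The outer ladder: `EmbedsInR5 ∧ F1 ∧ S3'' ∧ Schoenflies ∧ Γ₄ = 0 ⟹ SPC4` -/

/-- **The outer ladder of line `shadow-pleats`.**  If every homotopy 4-sphere embeds in `ℝ⁵` (`EmbedsInR5`),
Eliashberg–Mishachev's double-fold theorem holds (F1), every pleated round-rim position of a homotopy 4-sphere can be
replaced by an un-nested outer-clean position with at most one chart (S3'' `stub_outerNormalisation`, verbatim), and the
smooth 4-dimensional Schoenflies conjecture and Cerf's `Γ₄ = 0` hold, then every smooth homotopy 4-sphere is
diffeomorphic to `S⁴`: embed (h1) ⟶ pleated position (S2, `stub_roundRimNormalForm_of_facts` with the tree theorems F2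
`exists_isSmoothEmbedding_roundPart_holds` and F3 `hasTransversalRotation_of_homotopyEquiv_sphere_four_holds`) ⟶
outer-clean position with `k' ≤ 1` charts (hN) ⟶ `k' = 0`: S6 `stub_pleatFreeStandard`; `k' = 1`: S4''σ
`stub_outerCleanRecognitionOfSide` fed with the side lemma O1 `stub_outerSideLemma`. [folklore] -/
theorem nonempty_diffeomorph_sphere_of_outerNormalisation
    (h1 : Summit.SmoothPoincare4.SmoothPoincare4.Theses.AlgebraicDegree.EmbedsInR5)
    (hEM : Literature.Topology.Immersions.EliashbergMishachev2009_doubleFolds_of_hasTransversalRotation)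
    (hN : ∀ (M : Type) [TopologicalSpace M] [T2Space M] [SecondCountableTopology M]
      [ChartedSpace (EuclideanSpace ℝ (Fin 4)) M] [IsManifold (𝓡 4) ∞ M],
      M ≃ₕ (Metric.sphere (0 : EuclideanSpace ℝ (Fin 5)) 1) →
      ∀ k, HasPleatedPosition M k → ∃ k', k' ≤ 1 ∧ HasOuterCleanPleatedPosition M k')
    (hSch : Summit.SmoothPoincare4.SmoothPoincare4.Theses.EuclideanOrigami.Schoenflies)
    (hCerf : Summit.SmoothPoincare4.SmoothPoincare4.Theses.SymplecticOrigami.CerfGammaFour)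
    (M : Type) [TopologicalSpace M] [T2Space M] [SecondCountableTopology M]
    [ChartedSpace (EuclideanSpace ℝ (Fin 4)) M] [IsManifold (𝓡 4) ∞ M]
    (hM : M ≃ₕ (Metric.sphere (0 : EuclideanSpace ℝ (Fin 5)) 1)) :
    Nonempty (M ≃ₘ⟮𝓡 4, 𝓡 4⟯ (Metric.sphere (0 : EuclideanSpace ℝ (Fin 5)) 1)) := by
  haveI : CompactSpace M :=
    Literature.Topology.FourManifolds.compactSpace_of_homotopyEquiv_sphere_four_holds M hM
  obtain ⟨o⟩ :=
    Literature.Topology.FourManifolds.isOrientable_of_homotopyEquiv_sphere_four_holds M hM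
  obtain ⟨ι₀, hι₀⟩ := h1 ⟨M, o, ⟨hM⟩⟩
  obtain ⟨k, hk⟩ := stub_roundRimNormalForm_of_facts hEM
    Literature.Topology.Immersions.exists_isSmoothEmbedding_roundPart_holds
    Literature.Topology.Immersions.hasTransversalRotation_of_homotopyEquiv_sphere_four_holds M ι₀ hM hι₀
  obtain ⟨k', hk'le, hk'⟩ := hN M hM k hk
  interval_cases k'
  · exact stub_pleatFreeStandard M hM ((hasOuterCleanPleatedPosition_zero_iff M).1 hk')
  · exact stub_outerCleanRecognitionOfSide stub_outerSideLemma hSch hCerf M hM hk'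

/-- **`SmoothPoincare4` from the outer ladder.**  Packaging of
`nonempty_diffeomorph_sphere_of_outerNormalisation` as the summit statement. [folklore] -/
theorem smoothPoincare4_of_outerNormalisation
    (h1 : Summit.SmoothPoincare4.SmoothPoincare4.Theses.AlgebraicDegree.EmbedsInR5)
    (hEM : Literature.Topology.Immersions.EliashbergMishachev2009_doubleFolds_of_hasTransversalRotation)
    (hN : ∀ (M : Type) [TopologicalSpace M] [T2Space M] [SecondCountableTopology M]
      [ChartedSpace (EuclideanSpace ℝ (Fin 4)) M] [IsManifold (𝓡 4) ∞ M],
      M ≃ₕ (Metric.sphere (0 : EuclideanSpace ℝ (Fin 5)) 1) →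
      ∀ k, HasPleatedPosition M k → ∃ k', k' ≤ 1 ∧ HasOuterCleanPleatedPosition M k')
    (hSch : Summit.SmoothPoincare4.SmoothPoincare4.Theses.EuclideanOrigami.Schoenflies)
    (hCerf : Summit.SmoothPoincare4.SmoothPoincare4.Theses.SymplecticOrigami.CerfGammaFour) :
    _root_.SmoothPoincare4 := by
  unfold _root_.SmoothPoincare4 Literature.SPC4.SmoothPoincareConjectureFour
    ContinuousMap.HomotopyEquiv.NonemptyDiffeomorphSphere
  intro M _ _ _ _ _ hM
  exact nonempty_diffeomorph_sphere_of_outerNormalisation h1 hEM hN hSch hCerf M hM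

/-- **The crux `OrigamiFoldExistence` from the outer ladder** (the line's kernel endpoint, r10): the registered
stubs F1 and S3'', the route items `EmbedsInR5` (AlgebraicDegree, stmt-3403), `Schoenflies` (EuclideanOrigami,
stmt-10753) and `CerfGammaFour` (stmt-8758) imply the crux; the round-sphere fold `RoundSphereIsOrigamiFold`
(stmt-7845) is the CLOSED item `roundSphereIsOrigamiFold_proof`, and the fold data transport along the diffeomorphism
(`Negative.origamiFoldExistence_of_smoothPoincare4`, p72874). [folklore] -/
theorem origamiFoldExistence_of_outerNormalisation
    (h1 : Summit.SmoothPoincare4.SmoothPoincare4.Theses.AlgebraicDegree.EmbedsInR5)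
    (hEM : Literature.Topology.Immersions.EliashbergMishachev2009_doubleFolds_of_hasTransversalRotation)
    (hN : ∀ (M : Type) [TopologicalSpace M] [T2Space M] [SecondCountableTopology M]
      [ChartedSpace (EuclideanSpace ℝ (Fin 4)) M] [IsManifold (𝓡 4) ∞ M],
      M ≃ₕ (Metric.sphere (0 : EuclideanSpace ℝ (Fin 5)) 1) →
      ∀ k, HasPleatedPosition M k → ∃ k', k' ≤ 1 ∧ HasOuterCleanPleatedPosition M k')
    (hSch : Summit.SmoothPoincare4.SmoothPoincare4.Theses.EuclideanOrigami.Schoenflies)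
    (hCerf : Summit.SmoothPoincare4.SmoothPoincare4.Theses.SymplecticOrigami.CerfGammaFour) :
    Summit.SmoothPoincare4.SmoothPoincare4.Theses.SymplecticOrigami.OrigamiFoldExistence :=
  Negative.origamiFoldExistence_of_smoothPoincare4 (smoothPoincare4_of_outerNormalisation h1 hEM hN hSch hCerf)
    roundSphereIsOrigamiFold_proof

/-! ### The clean ladder: `EmbedsInR5 ∧ F1 ∧ CleanNormalisation₁ ⟹ SPC4` — no Schoenflies, no Cerf -/

/-- **The clean ladder of line `shadow-pleats` (Schoenflies-free, Cerf-free).**  If every homotopy 4-sphere embeds in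
`ℝ⁵`, Eliashberg–Mishachev's double-fold theorem holds, and every pleated round-rim position of a homotopy 4-sphere can
be replaced by a CLEAN position with at most one chart, then every smooth homotopy 4-sphere is diffeomorphic to `S⁴`:
`k' = 0` is S6 `stub_pleatFreeStandard`, `k' = 1` is S5a `stub_cleanOnePleatIroning` followed by S6 — both tree
theorems proved WITHOUT the Schoenflies conjecture and WITHOUT `Γ₄ = 0`. [folklore] -/
theorem nonempty_diffeomorph_sphere_of_cleanNormalisation
    (h1 : Summit.SmoothPoincare4.SmoothPoincare4.Theses.AlgebraicDegree.EmbedsInR5)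
    (hEM : Literature.Topology.Immersions.EliashbergMishachev2009_doubleFolds_of_hasTransversalRotation)
    (hN₁ : ∀ (M : Type) [TopologicalSpace M] [T2Space M] [SecondCountableTopology M]
      [ChartedSpace (EuclideanSpace ℝ (Fin 4)) M] [IsManifold (𝓡 4) ∞ M],
      M ≃ₕ (Metric.sphere (0 : EuclideanSpace ℝ (Fin 5)) 1) →
      ∀ k, HasPleatedPosition M k → ∃ k', k' ≤ 1 ∧ HasCleanPleatedPosition M k')
    (M : Type) [TopologicalSpace M] [T2Space M] [SecondCountableTopology M]
    [ChartedSpace (EuclideanSpace ℝ (Fin 4)) M] [IsManifold (𝓡 4) ∞ M]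
    (hM : M ≃ₕ (Metric.sphere (0 : EuclideanSpace ℝ (Fin 5)) 1)) :
    Nonempty (M ≃ₘ⟮𝓡 4, 𝓡 4⟯ (Metric.sphere (0 : EuclideanSpace ℝ (Fin 5)) 1)) := by
  haveI : CompactSpace M :=
    Literature.Topology.FourManifolds.compactSpace_of_homotopyEquiv_sphere_four_holds M hM
  obtain ⟨o⟩ :=
    Literature.Topology.FourManifolds.isOrientable_of_homotopyEquiv_sphere_four_holds M hM
  obtain ⟨ι₀, hι₀⟩ := h1 ⟨M, o, ⟨hM⟩⟩
  obtain ⟨k, hk⟩ := stub_roundRimNormalForm_of_facts hEM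
    Literature.Topology.Immersions.exists_isSmoothEmbedding_roundPart_holds
    Literature.Topology.Immersions.hasTransversalRotation_of_homotopyEquiv_sphere_four_holds M ι₀ hM hι₀
  obtain ⟨k', hk'le, hk'⟩ := hN₁ M hM k hk
  interval_cases k'
  · exact stub_pleatFreeStandard M hM ((hasCleanPleatedPosition_zero_iff M).1 hk')
  · exact stub_pleatFreeStandard M hM (stub_cleanOnePleatIroning M hM hk')

/-- **`SmoothPoincare4` from the clean ladder** (Schoenflies-free, Cerf-free packaging of
`nonempty_diffeomorph_sphere_of_cleanNormalisation`). [folklore] -/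
theorem smoothPoincare4_of_cleanNormalisation
    (h1 : Summit.SmoothPoincare4.SmoothPoincare4.Theses.AlgebraicDegree.EmbedsInR5)
    (hEM : Literature.Topology.Immersions.EliashbergMishachev2009_doubleFolds_of_hasTransversalRotation)
    (hN₁ : ∀ (M : Type) [TopologicalSpace M] [T2Space M] [SecondCountableTopology M]
      [ChartedSpace (EuclideanSpace ℝ (Fin 4)) M] [IsManifold (𝓡 4) ∞ M],
      M ≃ₕ (Metric.sphere (0 : EuclideanSpace ℝ (Fin 5)) 1) →
      ∀ k, HasPleatedPosition M k → ∃ k', k' ≤ 1 ∧ HasCleanPleatedPosition M k') :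
    _root_.SmoothPoincare4 := by
  unfold _root_.SmoothPoincare4 Literature.SPC4.SmoothPoincareConjectureFour
    ContinuousMap.HomotopyEquiv.NonemptyDiffeomorphSphere
  intro M _ _ _ _ _ hM
  exact nonempty_diffeomorph_sphere_of_cleanNormalisation h1 hEM hN₁ M hM

/-- **The crux from the clean ladder**: `EmbedsInR5`, F1 and clean normalisation to at most one chart imply
`OrigamiFoldExistence`, with no Schoenflies and no Cerf input (round-sphere fold by the closed item
`roundSphereIsOrigamiFold_proof`, transport by `Negative.origamiFoldExistence_of_smoothPoincare4`). [folklore] -/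
theorem origamiFoldExistence_of_cleanNormalisation
    (h1 : Summit.SmoothPoincare4.SmoothPoincare4.Theses.AlgebraicDegree.EmbedsInR5)
    (hEM : Literature.Topology.Immersions.EliashbergMishachev2009_doubleFolds_of_hasTransversalRotation)
    (hN₁ : ∀ (M : Type) [TopologicalSpace M] [T2Space M] [SecondCountableTopology M]
      [ChartedSpace (EuclideanSpace ℝ (Fin 4)) M] [IsManifold (𝓡 4) ∞ M],
      M ≃ₕ (Metric.sphere (0 : EuclideanSpace ℝ (Fin 5)) 1) →
      ∀ k, HasPleatedPosition M k → ∃ k', k' ≤ 1 ∧ HasCleanPleatedPosition M k') :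
    Summit.SmoothPoincare4.SmoothPoincare4.Theses.SymplecticOrigami.OrigamiFoldExistence :=
  Negative.origamiFoldExistence_of_smoothPoincare4 (smoothPoincare4_of_cleanNormalisation h1 hEM hN₁)
    roundSphereIsOrigamiFold_proof

/-! ### The converse by transport, and the reformulation `SPC4 ⟺ CleanNormalisation₁` -/

/-- **`SmoothPoincare4` implies clean normalisation to at most one chart** (indeed to NO chart): a homotopy 4-sphere
is then diffeomorphic to the round `S⁴ ⊂ ℝ⁵`, whose inclusion is a clean 0-chart position, and positions transport
along diffeomorphisms (`hasCleanPleatedPosition_zero_of_nonempty_diffeomorph`, p113474); the given position is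
ignored. [folklore] -/
theorem cleanNormalisation_of_smoothPoincare4 (hS : _root_.SmoothPoincare4) :
    ∀ (M : Type) [TopologicalSpace M] [T2Space M] [SecondCountableTopology M]
      [ChartedSpace (EuclideanSpace ℝ (Fin 4)) M] [IsManifold (𝓡 4) ∞ M],
      M ≃ₕ (Metric.sphere (0 : EuclideanSpace ℝ (Fin 5)) 1) →
      ∀ k, HasPleatedPosition M k → ∃ k', k' ≤ 1 ∧ HasCleanPleatedPosition M k' := by
  intro M _ _ _ _ _ hM k _
  have hS' := hS
  unfold _root_.SmoothPoincare4 Literature.SPC4.SmoothPoincareConjectureFour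
    ContinuousMap.HomotopyEquiv.NonemptyDiffeomorphSphere at hS'
  exact ⟨0, Nat.zero_le 1,
    hasCleanPleatedPosition_zero_of_nonempty_diffeomorph (hS' M inferInstance inferInstance hM)⟩

/-- **The line's reformulation of SPC4 (kernel form).**  Modulo the two theorems in print `EmbedsInR5`
(Kervaire–Milnor: every homotopy 4-sphere embeds in `ℝ⁵`) and F1 (Eliashberg–Mishachev's double folds), the smooth
4-dimensional Poincaré conjecture is EQUIVALENT to CLEAN NORMALISATION: every pleated round-rim shadow position of a
homotopy 4-sphere in `ℝ⁵` (any number of charts, wild and nested charts allowed) can be replaced by a clean position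
with at most one chart.  Neither the Schoenflies conjecture nor Cerf's theorem enters. [folklore] -/
theorem smoothPoincare4_iff_cleanNormalisation
    (h1 : Summit.SmoothPoincare4.SmoothPoincare4.Theses.AlgebraicDegree.EmbedsInR5)
    (hEM : Literature.Topology.Immersions.EliashbergMishachev2009_doubleFolds_of_hasTransversalRotation) :
    _root_.SmoothPoincare4 ↔
      ∀ (M : Type) [TopologicalSpace M] [T2Space M] [SecondCountableTopology M]
        [ChartedSpace (EuclideanSpace ℝ (Fin 4)) M] [IsManifold (𝓡 4) ∞ M],
        M ≃ₕ (Metric.sphere (0 : EuclideanSpace ℝ (Fin 5)) 1) →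
        ∀ k, HasPleatedPosition M k → ∃ k', k' ≤ 1 ∧ HasCleanPleatedPosition M k' :=
  ⟨cleanNormalisation_of_smoothPoincare4, smoothPoincare4_of_cleanNormalisation h1 hEM⟩

/-- **Clean normalisation implies outer normalisation** (S3'' `stub_outerNormalisation`, verbatim): for at most one
chart a clean position is an un-nested outer-clean one
(`HasCleanPleatedPosition.hasOuterCleanPleatedPosition_of_le_one`).  So the registered open stub S3'' is sandwiched
between `SmoothPoincare4` (`stub_outerNormalisation_of_smoothPoincare4` / `cleanNormalisation_of_smoothPoincare4`) and
`Schoenflies → CerfGammaFour → SmoothPoincare4` (`smoothPoincare4_of_outerNormalisation`). [folklore] -/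
theorem outerNormalisation_of_cleanNormalisation
    (hN₁ : ∀ (M : Type) [TopologicalSpace M] [T2Space M] [SecondCountableTopology M]
      [ChartedSpace (EuclideanSpace ℝ (Fin 4)) M] [IsManifold (𝓡 4) ∞ M],
      M ≃ₕ (Metric.sphere (0 : EuclideanSpace ℝ (Fin 5)) 1) →
      ∀ k, HasPleatedPosition M k → ∃ k', k' ≤ 1 ∧ HasCleanPleatedPosition M k') :
    ∀ (M : Type) [TopologicalSpace M] [T2Space M] [SecondCountableTopology M]
      [ChartedSpace (EuclideanSpace ℝ (Fin 4)) M] [IsManifold (𝓡 4) ∞ M],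
      M ≃ₕ (Metric.sphere (0 : EuclideanSpace ℝ (Fin 5)) 1) →
      ∀ k, HasPleatedPosition M k → ∃ k', k' ≤ 1 ∧ HasOuterCleanPleatedPosition M k' := by
  intro M _ _ _ _ _ hM k hk
  obtain ⟨k', hk'le, hk'⟩ := hN₁ M hM k hk
  exact ⟨k', hk'le, hk'.hasOuterCleanPleatedPosition_of_le_one hk'le⟩

/-- **Relative SPC4-equivalence of S3'' (kernel form of the verdict).**  Under the line's standing inputs — the
theorems in print `EmbedsInR5` and F1, the smooth 4-dimensional Schoenflies conjecture and Cerf's `Γ₄ = 0` — the open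
stub S3'' `stub_outerNormalisation` holds if and only if `SmoothPoincare4` does. [folklore] -/
theorem smoothPoincare4_iff_outerNormalisation
    (h1 : Summit.SmoothPoincare4.SmoothPoincare4.Theses.AlgebraicDegree.EmbedsInR5)
    (hEM : Literature.Topology.Immersions.EliashbergMishachev2009_doubleFolds_of_hasTransversalRotation)
    (hSch : Summit.SmoothPoincare4.SmoothPoincare4.Theses.EuclideanOrigami.Schoenflies)
    (hCerf : Summit.SmoothPoincare4.SmoothPoincare4.Theses.SymplecticOrigami.CerfGammaFour) :
    _root_.SmoothPoincare4 ↔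
      ∀ (M : Type) [TopologicalSpace M] [T2Space M] [SecondCountableTopology M]
        [ChartedSpace (EuclideanSpace ℝ (Fin 4)) M] [IsManifold (𝓡 4) ∞ M],
        M ≃ₕ (Metric.sphere (0 : EuclideanSpace ℝ (Fin 5)) 1) →
        ∀ k, HasPleatedPosition M k → ∃ k', k' ≤ 1 ∧ HasOuterCleanPleatedPosition M k' :=
  ⟨stub_outerNormalisation_of_smoothPoincare4,
    fun hN => smoothPoincare4_of_outerNormalisation h1 hEM hN hSch hCerf⟩

end Summit.SmoothPoincare4.SmoothPoincare4.Theorems.OrigamiFoldExistence.ShadowPleats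

end
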